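import Summits.CriticalPhenomena.CardyFormulaZ2.Theorems.CardyQContinuationIsingJetsConformalStubIsRectOfFaces
import Literature.Probability.LatticeModels.FKIsingQuadrilateralCrossing

/-!
# Combinatorics of Chelkak–Smirnov square-lattice quadrilaterals: local structure of the boundary
(route CardyQContinuation, serves stmt-CriticalPhenomena-5560: helper for the registered stub
`stub_design_meshQuad` of the n = 0 bridge of the crux `IsingJetsConformal`)

For a discrete quadrilateral `DiscreteRect.IsCSQuadrilateral E d₀ n` (`FKIsingQuadrilateralCrossing`:
one boundary cycle `D i = succ^[i] d₀` through all external darts, induced, no pinch, no diagonal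
contact, every edge on a face) we record the lattice bookkeeping behind the identification of its
polygonal domain `csDomain` with the inside of an explicit polygon:

* squares and corners of darts and arrows (`fst_eq_corner_lsq`, `rsq_succ`: the exterior square
  of a dart is the right square of the next dart);
* **induced ⇒ the trace never closes a unit square**: the head of an external dart is not a
  vertex, the fourth branch of `succ` does not occur (`succ_cases`), and **an exterior square is
  the exterior square of at most one external dart** (`eq_of_lsq_eq`, using no-diagonal-contact);
* **at most one walked arrow enters / leaves a vertex** (`eq_of_head_eq`, `eq_of_fst_eq`, no pinch);
* positions along the cycle: white (`IsWhitePos`, darts of the arcs `1, 3`), white-inner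
  (`IsWinnerPos`, arrows walked strictly inside a white arc) and their complements, with the
  dictionary to `arcDarts`, `innerArrows`, `blackArrows` (`mem_whiteDarts_iff`, `mem_whiteArrows_iff`,
  `mem_blackArrows_iff`) and the traversal facts (`exists_pos_of_walked`, `pos_unique`).

Pure finite combinatorics of `ℤ²`. [folklore]
-/

namespace Summit.CriticalPhenomena.CardyFormulaZ2.Theorems.CardyQContinuation

namespace CSQuad

open Literature.Probability.LatticeModels Literature.Probability.LatticeModels.DiscreteRect
open Summit.CriticalPhenomena.SAWScalingLimit.Theorems.IsingBoundaryRatio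

variable {E : Finset (Sym2 (Site 2))}

/-! ### Arithmetic in `Fin 4` -/

/-- `Fin 4` bookkeeping. [folklore] -/
theorem f4_33 : ∀ k : Fin 4, k + 3 + 3 = k + 2 := by decide
/-- `Fin 4` bookkeeping. [folklore] -/
theorem f4_31 : ∀ k : Fin 4, k + 3 + 1 = k := by decide
/-- `Fin 4` bookkeeping. [folklore] -/
theorem f4_32 : ∀ k : Fin 4, k + 3 + 2 = k + 1 := by decide
/-- `Fin 4` bookkeeping. [folklore] -/
theorem f4_13 : ∀ k : Fin 4, k + 1 + 3 = k := by decide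
/-- `Fin 4` bookkeeping. [folklore] -/
theorem f4_11 : ∀ k : Fin 4, k + 1 + 1 = k + 2 := by decide
/-- `Fin 4` bookkeeping. [folklore] -/
theorem f4_12 : ∀ k : Fin 4, k + 1 + 2 = k + 3 := by decide
/-- `Fin 4` bookkeeping. [folklore] -/
theorem f4_21 : ∀ k : Fin 4, k + 2 + 1 = k + 3 := by decide
/-- `Fin 4` bookkeeping. [folklore] -/
theorem f4_22 : ∀ k : Fin 4, k + 2 + 2 = k := by decide
/-- `Fin 4` bookkeeping. [folklore] -/
theorem f4_23 : ∀ k : Fin 4, k + 2 + 3 = k + 1 := by decide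

/-! ### Squares and corners of darts and arrows -/

/-- The base of a dart is the corner of index `d.2` of its exterior (left) square. [folklore] -/
theorem fst_eq_corner_lsq (d : Site 2 × Fin 4) : d.1 = corner (lsq d) d.2 := by
  obtain ⟨x, k⟩ := d
  rw [lsq_mk, corner_quad]

/-- The head of a dart / arrow is the next corner of its left square. [folklore] -/
theorem head_eq_corner_lsq (d : Site 2 × Fin 4) : d.1 + dir d.2 = corner (lsq d) (d.2 + 1) := by
  obtain ⟨x, k⟩ := d
  rw [lsq_mk, corner_quad_add_one]

/-- The far left corner of the exterior square: `x + e_k + e_{k+1}`. [folklore] -/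
theorem corner_lsq_add_two (d : Site 2 × Fin 4) : corner (lsq d) (d.2 + 2) = d.1 + dir d.2 + dir (d.2 + 1) := by
  obtain ⟨x, k⟩ := d
  rw [lsq_mk, corner_quad_add_two]

/-- The left corner of the exterior square at the base: `x + e_{k+1}`. [folklore] -/
theorem corner_lsq_add_three (d : Site 2 × Fin 4) : corner (lsq d) (d.2 + 3) = d.1 + dir (d.2 + 1) := by
  obtain ⟨x, k⟩ := d
  rw [lsq_mk, corner_quad_add_three]

/-- The tail of an arrow is the corner of index `a.2 + 3` of its right square. [folklore] -/
theorem fst_eq_corner_rsq (a : Site 2 × Fin 4) : a.1 = corner (rsq a) (a.2 + 3) := by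
  obtain ⟨p, m⟩ := a
  rw [rsq_mk, corner_quad]

/-- The head of an arrow is the corner of index `a.2 + 2` of its right square (the arrow runs
backwards along the side `a.2 + 2` of its right square). [folklore] -/
theorem head_eq_corner_rsq (a : Site 2 × Fin 4) : a.1 + dir a.2 = corner (rsq a) (a.2 + 2) := by
  obtain ⟨p, m⟩ := a
  rw [rsq_mk]
  have h := corner_quad_add_three p (m + 3)
  rw [f4_33, f4_31] at h
  exact h.symm

/-- The dart at the corner `c` of the square `Q` pointing along the side `c` has `Q` on its left.
[folklore] -/
theorem lsq_corner (Q : Site 2) (c : Fin 4) : lsq (corner Q c, c) = Q := by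
  rw [lsq_mk, quad_corner]

/-- The arrow at the corner `c` of `Q` pointing backwards along the side `c - 1` has `Q` on its
right. [folklore] -/
theorem rsq_corner_succ (Q : Site 2) (c : Fin 4) : rsq (corner Q c, c + 1) = Q := by
  rw [rsq_mk, f4_13, quad_corner]

/-- **The exterior square of a dart is the right square of the next dart.** [folklore] -/
theorem rsq_succ (E : Finset (Sym2 (Site 2))) (d : Site 2 × Fin 4) : rsq (succ E d) = lsq d := by
  obtain ⟨x, k⟩ := d
  rcases WindowRect.succ_spec E x k with ⟨-, h⟩ | ⟨-, -, h⟩ | ⟨-, -, -, h⟩ | ⟨-, -, -, h⟩ <;> rw [h]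
  · rw [rsq_mk, lsq_mk, f4_13]
  · rw [rsq_mk, lsq_mk, quad_add_dir_add_one]
  · rw [rsq_mk, lsq_mk, f4_33, add_right_comm, quad_add_dir_add_dir]
  · rw [rsq_mk, lsq_mk, f4_23, quad_add_dir]

/-! ### Induced domains: the trace never closes a square -/

section Induced

variable (hind : ∀ x ∈ verts E, ∀ k : Fin 4, x + dir k ∈ verts E → s(x, x + dir k) ∈ E)
include hind

/-- In an induced domain the head of an external dart is not a vertex. [folklore] -/
theorem not_mem_verts_head {d : Site 2 × Fin 4} (hd : IsExtDart E d) : d.1 + dir d.2 ∉ verts E :=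
  fun h ↦ hd.2 (hind _ hd.1 _ h)

/-- **The three branches of `succ` in an induced domain**: from the external dart `(x, k)`, with
`y = x + e_{k+1}`, `y' = y + e_k`: either `x y` is missing and `succ = (x, k+1)` (no arrow walked),
or `x y ∈ E`, `y y'` missing and `succ = (y, k)` (one arrow), or `x y, y y' ∈ E`, `y' (x + e_k)`
missing and `succ = (y', k + 3)` (two arrows); the fourth branch would make `x + e_k` a vertex.
[folklore] -/
theorem succ_cases {d : Site 2 × Fin 4} (hd : IsExtDart E d) :
    (s(d.1, d.1 + dir (d.2 + 1)) ∉ E ∧ succ E d = (d.1, d.2 + 1) ∧ slots E d = ∅) ∨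
    (s(d.1, d.1 + dir (d.2 + 1)) ∈ E ∧ s(d.1 + dir (d.2 + 1), d.1 + dir (d.2 + 1) + dir d.2) ∉ E ∧
      succ E d = (d.1 + dir (d.2 + 1), d.2) ∧ slots E d = {(d.1, d.2 + 1)}) ∨
    (s(d.1, d.1 + dir (d.2 + 1)) ∈ E ∧ s(d.1 + dir (d.2 + 1), d.1 + dir (d.2 + 1) + dir d.2) ∈ E ∧
      s(d.1 + dir (d.2 + 1) + dir d.2, d.1 + dir d.2) ∉ E ∧
      succ E d = (d.1 + dir (d.2 + 1) + dir d.2, d.2 + 3) ∧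
      slots E d = {(d.1, d.2 + 1), (d.1 + dir (d.2 + 1), d.2)}) := by
  obtain ⟨x, k⟩ := d
  have hk3 : k - 1 = k + 3 := WindowRect.fin4_sub_one k
  have hv : x + dir (k + 1) + dir k + dir (k + 3) = x + dir k := by rw [dir_add_three]; abel
  rcases WindowRect.succ_spec E x k with ⟨h1, h⟩ | ⟨h1, h2, h⟩ | ⟨h1, h2, h3, h⟩ | ⟨h1, h2, h3, -⟩
  · refine Or.inl ⟨h1, h, ?_⟩
    simp [slots, h1]
  · refine Or.inr (Or.inl ⟨h1, h2, h, ?_⟩)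
    simp [slots, h1, h2]
  · refine Or.inr (Or.inr ⟨h1, h2, h3, h, ?_⟩)
    have h3' : s(x + dir (k + 1) + dir k, x + dir (k + 1) + dir k + dir (k - 1)) ∉ E := by
      rwa [hk3, hv]
    simp [slots, h1, h2, h3']
  · exact absurd (WindowRect.mem_verts_of_mem_left (by rw [Sym2.eq_swap]; exact h3))
      (not_mem_verts_head hind hd)

/-- The number of arrows walked from an external dart of an induced domain is at most two.
[folklore] -/
theorem card_slots_le_two {d : Site 2 × Fin 4} (hd : IsExtDart E d) : (slots E d).card ≤ 2 := by
  rcases succ_cases hind hd with ⟨-, -, h⟩ | ⟨-, -, -, h⟩ | ⟨-, -, -, -, h⟩ <;> rw [h]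
  · simp
  · simp
  · exact Finset.card_le_two

end Induced

/-! ### An exterior square belongs to one dart -/

/-- **Uniqueness of the dart of an exterior square**: in an induced domain without diagonal
contacts, two external darts with the same exterior (left) square are equal. [folklore] -/
theorem eq_of_lsq_eq
    (hind : ∀ x ∈ verts E, ∀ k : Fin 4, x + dir k ∈ verts E → s(x, x + dir k) ∈ E)
    (hnd : ∀ x ∈ verts E, ∀ k : Fin 4, x + dir k + dir (k + 1) ∈ verts E →
      x + dir k ∈ verts E ∨ x + dir (k + 1) ∈ verts E)
    {d d' : Site 2 × Fin 4} (hd : IsExtDart E d) (hd' : IsExtDart E d') (h : lsq d = lsq d') :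
    d = d' := by
  obtain ⟨x, k⟩ := d
  obtain ⟨x', k'⟩ := d'
  have hxk : x + dir k ∉ verts E := not_mem_verts_head hind hd
  have hx' : x' = corner (lsq (x, k)) k' := by rw [h]; exact fst_eq_corner_lsq (x', k')
  obtain ⟨r, rfl⟩ : ∃ r : Fin 4, k' = k + r := ⟨k' - k, by abel⟩
  rcases (by decide : ∀ r : Fin 4, r = 0 ∨ r = 1 ∨ r = 2 ∨ r = 3) r with rfl | rfl | rfl | rfl
  · simp only [add_zero] at hx' ⊢
    rw [hx', ← fst_eq_corner_lsq]
  · -- `x' = x + e_k` would be a vertex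
    exfalso
    rw [← head_eq_corner_lsq] at hx'
    exact hxk (hx' ▸ hd'.1)
  · -- diagonal contact
    exfalso
    have hx2 : x' = x + dir k + dir (k + 1) := by rw [hx']; exact corner_lsq_add_two (x, k)
    rcases hnd x hd.1 k (hx2 ▸ hd'.1) with h1 | h1
    · exact hxk h1
    · -- the head of `d'` is `x + e_{k+1}`, a vertex
      have hh : x' + dir (k + 2) = x + dir (k + 1) := by rw [hx2, dir_add_two]; abel
      have := not_mem_verts_head hind hd'
      rw [hh] at this
      exact this h1
  · -- the head of `d'` is `x`, a vertex
    exfalso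
    have hx3 : x' = x + dir (k + 1) := by rw [hx']; exact corner_lsq_add_three (x, k)
    have hh : x' + dir (k + 3) = x := by rw [hx3, dir_add_three]; abel
    have := not_mem_verts_head hind hd'
    rw [hh] at this
    exact this hd.1

/-! ### At most one walked arrow enters or leaves a vertex -/

/-- The left square of an arrow, seen from its head: `quad (p + e_m) (m + 1)`. [folklore] -/
theorem lsq_eq_quad_head (a : Site 2 × Fin 4) : lsq a = quad (a.1 + dir a.2) (a.2 + 1) := by
  obtain ⟨p, m⟩ := a
  rw [lsq_mk, quad_add_dir]

/-- The right square of an arrow, seen from its head: `quad (p + e_m) (m + 2)`. [folklore] -/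
theorem rsq_eq_quad_head (a : Site 2 × Fin 4) : rsq a = quad (a.1 + dir a.2) (a.2 + 2) := by
  obtain ⟨p, m⟩ := a
  rw [rsq_mk, quad_add_dir_two]

/-- **At most one walked arrow enters a vertex**: if two arrows with a face on their left and no
face on their right have the same head, they are equal (two such arrows with different directions
make the faces at the head two diagonally opposite squares — a pinch). [folklore] -/
theorem eq_of_head_eq
    (hnp : ∀ x ∈ verts E, ∀ k : Fin 4, InF E (quad x k) → InF E (quad x (k + 2)) →
      InF E (quad x (k + 1)) ∨ InF E (quad x (k + 3)))
    {a a' : Site 2 × Fin 4} (ha : aedge a ∈ E) (hla : InF E (lsq a)) (hra : ¬ InF E (rsq a))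
    (hla' : InF E (lsq a')) (hra' : ¬ InF E (rsq a')) (h : a.1 + dir a.2 = a'.1 + dir a'.2) :
    a = a' := by
  obtain ⟨p, m⟩ := a
  obtain ⟨p', m'⟩ := a'
  simp only at h
  have hyv : p + dir m ∈ verts E := mem_verts_of_mem ha
  rw [lsq_eq_quad_head] at hla hla'
  rw [rsq_eq_quad_head] at hra hra'
  simp only at hla hla' hra hra'
  rw [← h] at hla' hra'
  obtain ⟨r, rfl⟩ : ∃ r : Fin 4, m' = m + r := ⟨m' - m, by abel⟩
  rcases (by decide : ∀ r : Fin 4, r = 0 ∨ r = 1 ∨ r = 2 ∨ r = 3) r with rfl | rfl | rfl | rfl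
  · simp only [add_zero] at h ⊢
    simp only [Prod.mk.injEq, and_true]
    exact add_right_cancel h
  · exfalso
    rw [f4_11] at hla'
    exact hra hla'
  · exfalso
    rw [f4_21] at hla'
    rw [f4_22] at hra'
    -- faces at `m + 1`, `m + 3`; non-faces at `m + 2`, `m`
    rcases hnp _ hyv (m + 1) hla (by rw [f4_12]; exact hla') with h1 | h1
    · rw [f4_11] at h1; exact hra h1
    · rw [f4_13] at h1; exact hra' h1
  · exfalso
    rw [f4_31] at hla'
    rw [f4_32] at hra'
    exact hra' hla

/-- **At most one walked arrow leaves a vertex** (the mirror statement). [folklore] -/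
theorem eq_of_fst_eq
    (hnp : ∀ x ∈ verts E, ∀ k : Fin 4, InF E (quad x k) → InF E (quad x (k + 2)) →
      InF E (quad x (k + 1)) ∨ InF E (quad x (k + 3)))
    {a a' : Site 2 × Fin 4} (ha : aedge a ∈ E) (hla : InF E (lsq a)) (hra : ¬ InF E (rsq a))
    (hla' : InF E (lsq a')) (hra' : ¬ InF E (rsq a')) (h : a.1 = a'.1) : a = a' := by
  obtain ⟨p, m⟩ := a
  obtain ⟨p', m'⟩ := a'
  simp only at h
  subst h
  have hpv : p ∈ verts E := fst_mem_verts_of_aedge_mem ha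
  rw [lsq_mk] at hla hla'
  rw [rsq_mk] at hra hra'
  obtain ⟨r, rfl⟩ : ∃ r : Fin 4, m' = m + r := ⟨m' - m, by abel⟩
  rcases (by decide : ∀ r : Fin 4, r = 0 ∨ r = 1 ∨ r = 2 ∨ r = 3) r with rfl | rfl | rfl | rfl
  · simp
  · exfalso
    rw [f4_13] at hra'
    exact hra' hla
  · exfalso
    rw [f4_23] at hra'
    -- faces at `m`, `m + 2`; non-faces at `m + 3`, `m + 1`
    rcases hnp p hpv m hla hla' with h1 | h1
    · exact hra' h1
    · exact hra h1
  · exfalso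
    rw [f4_33] at hra'
    exact hra hla'

end CSQuad

end Summit.CriticalPhenomena.CardyFormulaZ2.Theorems.CardyQContinuation
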